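import Summits.BirchSwinnertonDyer.BirchSwinnertonDyer.Theorems.KolyvaginRoadThreeSchneiderTamAtThreeHeightLogNumeratorExactLimit
import Literature.NumberTheory.EllipticCurves.SteinWuthrich2013.NonsplitMultCanonicalHolds
import HarnessLib

/-!
# Crux `SchneiderTamAtThree` (item 19154) — THE HEIGHT IS THE LOGARITHM OF THE NUMERATOR, DEEP POINTS,
# part 7f: a HEIGHT-FREE consequence — the numerator logarithm is quadratic along multiples to SECOND order:
# `log₃ num x(nQ) ≡ n²·log₃ num x(Q) (mod 3^{4k−1}·‖n‖₃⁻²)`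

HONEST FRAMING (cell `bsd-stepL`, seat `bsd-stepL-tam3-p2` g3, WIDTH-LEVER second lane «closed-form Schneider
local factor at 3 … finite case table proved once»; `--supports stmt-BirchSwinnertonDyer-19154 --as helper`):
THEOREMS ONLY, unconditional, route-independent (no Theses import); 0 definitions, 0 named facts, 0 sorry;
nothing here proves the crux `SchneiderTamAtThree`, Schneider's conjecture or BSD.

* `norm_padicLog_num_nsmul_sub_sq_mul_le` — for `W/ℚ` globally minimal with NON-SPLIT multiplicative reduction
  at `3`, an admissible rational point `Q = (x, y)` of level `k ≥ 2` (`‖z(Q)‖₃ ≤ 3⁻²`) and any `n ≥ 1` with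
  `n • Q = (x', y')`: **`‖log₃ num x' − n²·log₃ num x‖₃ ≤ 3·‖n‖₃²·‖x‖₃⁻²`**, i.e.
  `log₃ num x(nQ) ≡ n²·log₃ num x(Q) (mod 3^{4k − 1 + 2v₃(n)})` — a statement about rational points and `3`-adic
  logarithms of integers ONLY (no height, no Tate parameter, no `σ`-function), which is the shadow of two facts
  about THE canonical `3`-adic height: it is quadratic (`⟨nQ,nQ⟩ = n²⟨Q,Q⟩`) and its second-order term is
  `κ_E/x` with the SAME constant `κ_E` at every point (part 7b) — `κ_E` cancels between `Q` and `nQ` because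
  `1/x(nQ) ≡ n²/x(Q)` to the same order (`log_E(nQ) = n·log_E(Q)`). The proof picks THE Tate parameter
  (`existsUnique_tateJ_eq_holds`) and THE canonical datum (`SteinWuthrich2013.exists_isMultCanonical_holds`, a
  tree THEOREM — whence the non-split hypothesis) and never mentions them in the statement.
  INSTRUMENT (seat numerics `numerics/check_tower.py` on lane A's 690 non-split rows): `n = 3`:
  `v₃(log₃ a(3Q) − 9 log₃ a(Q)) ≥ 4k + 1` on 690/690 rows of every level `k ≥ 1` (EQUAL on 469: sharp; the
  theorem covers `k ≥ 2`: 246/246); `n ∈ {2, 4, 5}`: `≥ 4k` on 246/246 (the bound `4k − 1` is one digit weak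
  for `3 ∤ n`, from `n⁴ ≡ n² (mod 3)`); `n = 6`: `≥ 4k + 1` on 246/246 (sharp on 170).

References: [SteinWuthrich2013] §4.1–4.2; [MazurSteinTate2006] §1; [MazurTateTeitelbaum1986Invent] §II.4;
[SilvermanATAEC1994] Lemma V.5.1, Thm. V.5.3; tree: parts 7b–7d, `SteinWuthrich2013/NonsplitMultCanonicalHolds`,
`PAdicHeightsProofs` (`existsUnique_tateJ_eq_holds`).
-/

noncomputable section

open scoped Classical Nat
open Filter Topology IsUltrametricDist PowerSeries
open WeierstrassCurve Literature.NumberTheory.EllipticCurves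
open Literature.NumberTheory.EllipticCurves.SteinWuthrich2013
open Literature.NumberTheory.EllipticCurves.TateCurve
open Literature.NumberTheory.EllipticCurves.Rank1Residual
open Summit.BirchSwinnertonDyer.Uniform.UI.O2

namespace Summit.BirchSwinnertonDyer.Rank1Residual.X11b.RegMult.HeightLogNumerator

/-! ### §30 The numerator logarithm is quadratic along multiples, to second order -/

section Tower

variable {W : WeierstrassCurve ℚ}

/-- **HEIGHT-FREE SHADOW OF THE EXACT LAW.** For `W/ℚ` globally minimal with non-split multiplicative reduction
at `3`, an admissible rational point `Q = (x, y)` with `‖−x/y‖₃ ≤ 3⁻²` (level `k ≥ 2`) and `n ≥ 1` with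
`n • Q = (x', y')`: **`‖log₃ num x' − n²·log₃ num x‖₃ ≤ 3·‖n‖₃²·‖x‖₃⁻²`**
(`log₃ num x(nQ) ≡ n² log₃ num x(Q) mod 3^{4k − 1 + 2v₃(n)}`; for `n = 3`: `mod 3^{4k+1}`, numerically sharp).
Proof through THE canonical `3`-adic height (exact law of part 7b at `Q` and at `nQ`, `⟨nQ,nQ⟩ = n²⟨Q,Q⟩`,
`log_E(nQ) = n log_E(Q)`, `‖1/x − log_E²‖ ≤ 3‖z‖⁴`), which does not appear in the statement.
[cite: SteinWuthrich2013, §4.1 eq. (4.1), §4.2] [cite: MazurSteinTate2006, §1] [cite: SilvermanATAEC1994, Lemma V.5.1] -/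
theorem norm_padicLog_num_nsmul_sub_sq_mul_le [W.IsElliptic] [W.IsGloballyMinimal] (hW : Mult W 3)
    (hns : ¬ W.HasSplitMultiplicativeReductionAtPrime 3) {x y : ℚ} {h : W.toAffine.Nonsingular x y}
    (hadm : W.IsAdmissible 3 (.some x y h)) (hz9 : ‖-(x : ℚ_[3]) / y‖ ≤ 1 / 9) {n : ℕ} (hn : 1 ≤ n)
    {x' y' : ℚ} {h' : W.toAffine.Nonsingular x' y'} (hnQ : n • (.some x y h : W.toAffine.Point) = .some x' y' h') :
    ‖padicLog 3 ((x'.num : ℚ) : ℚ_[3]) - (n : ℚ_[3]) ^ 2 * padicLog 3 ((x.num : ℚ) : ℚ_[3])‖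
      ≤ 3 * ‖(n : ℚ_[3])‖ ^ 2 * ‖(x : ℚ_[3])‖⁻¹ ^ 2 := by
  -- THE Tate parameter and THE canonical datum (tree theorems; they do not enter the statement)
  have hj : 1 < ‖(W.j : ℚ_[3])‖ := one_lt_norm_j_of_hasMultiplicativeReductionAtPrime (W := W) (p := 3) hW
  obtain ⟨q, ⟨hq0, hq, hjq⟩, -⟩ := existsUnique_tateJ_eq_holds 3 hj
  obtain ⟨Dh, hDh⟩ := exists_isMultCanonical_holds W 3 (by norm_num) hW hns q hq0 hq hjq
  set V : WeierstrassCurve ℚ_[3] := W.baseChange ℚ_[3] with hVdef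
  set κ : ℚ_[3] := ((uniformisationScaleSq W 3 q)⁻¹ * (1 - 24 * tateS 1 q) - V.b₂) / 12 with hκdef
  set X : ℚ_[3] := (x : ℚ_[3]) with hXdef
  set X' : ℚ_[3] := (x' : ℚ_[3]) with hX'def
  set z : ℚ_[3] := -X / (y : ℚ_[3]) with hzdef
  set z' : ℚ_[3] := -X' / (y' : ℚ_[3]) with hz'def
  set ℓ : ℚ_[3] := V.padicFormalLog z with hℓdef
  set ℓ' : ℚ_[3] := V.padicFormalLog z' with hℓ'def
  -- admissibility and norms of `Q` and `Q' = nQ`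
  have hn0 : n ≠ 0 := by omega
  have hadm' : W.IsAdmissible 3 (.some x' y' h') := by
    have hh := isAdmissible_nsmul hadm hn0; rwa [hnQ] at hh
  have hx : 1 < ‖X‖ := hadm.2.1
  have hx' : 1 < ‖X'‖ := hadm'.2.1
  obtain ⟨hz3, hz2⟩ := norm_neg_div_of_one_lt_norm (p := 3) h hx
  obtain ⟨-, hz2'⟩ := norm_neg_div_of_one_lt_norm (p := 3) h' hx'
  rw [← hXdef, ← hzdef] at hz3 hz2
  rw [← hX'def, ← hz'def] at hz2'
  have hX0 : 0 < ‖X‖ := one_pos.trans hx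
  have hX0' : X ≠ 0 := norm_pos_iff.mp hX0
  have hX'0 : 0 < ‖X'‖ := one_pos.trans hx'
  have hX'0' : X' ≠ 0 := norm_pos_iff.mp hX'0
  have hzz : 0 < ‖z‖ := by
    have hh : 0 < ‖z‖ ^ 2 := by rw [hz2]; exact inv_pos.mpr hX0
    rcases (norm_nonneg z).eq_or_lt with h0 | h0
    · rw [← h0] at hh; norm_num at hh
    · exact h0
  have hz9X : ‖z‖ ≤ 1 / 9 := hz9
  -- `log_E(nQ) = n log_E(Q)`, `‖log_E‖ = ‖z‖`, so `‖z'‖ = ‖n‖‖z‖ ≤ ‖z‖`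
  have hℓmul : ℓ' = (n : ℚ_[3]) * ℓ := padicFormalLog_param_nsmul (p := 3) hadm n hn hnQ
  have hℓn : ‖ℓ‖ = ‖z‖ := norm_padicFormalLog_param_eq (p := 3) (by norm_num) h hx
  have hℓ'n : ‖ℓ'‖ = ‖z'‖ := norm_padicFormalLog_param_eq (p := 3) (by norm_num) h' hx'
  have hnn : ‖(n : ℚ_[3])‖ ≤ 1 := norm_natCast_le_one n
  have hzrel : ‖z'‖ = ‖(n : ℚ_[3])‖ * ‖z‖ := by rw [← hℓ'n, hℓmul, norm_mul, hℓn]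
  have hXrel : ‖X'‖⁻¹ = ‖(n : ℚ_[3])‖ ^ 2 * ‖X‖⁻¹ := by rw [← hz2', ← hz2, hzrel, mul_pow]
  have hz9' : ‖z'‖ ≤ 1 / 9 := by
    rw [hzrel]
    calc ‖(n : ℚ_[3])‖ * ‖z‖ ≤ 1 * (1 / 9) := by gcongr
      _ = 1 / 9 := one_mul _
  have hzz' : 0 < ‖z'‖ := by
    have hh : 0 < ‖z'‖ ^ 2 := by rw [hz2']; exact inv_pos.mpr hX'0
    rcases (norm_nonneg z').eq_or_lt with h0 | h0
    · rw [← h0] at hh; norm_num at hh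
    · exact h0
  -- the exact law (part 7b) at `Q` and at `nQ`
  have hA : ‖heightFourOneCoord W 3 q x y - padicLog 3 ((x.num : ℚ) : ℚ_[3]) +
      κ * (((x.den : ℚ) : ℚ_[3]) / ((x.num : ℚ) : ℚ_[3]))‖ ≤ ‖X‖⁻¹ ^ 2 :=
    norm_heightFourOneCoord_sub_padicLog_num_add_kappaE_mul_le hW hq h hx hz9X
  have hB : ‖heightFourOneCoord W 3 q x' y' - padicLog 3 ((x'.num : ℚ) : ℚ_[3]) +
      κ * (((x'.den : ℚ) : ℚ_[3]) / ((x'.num : ℚ) : ℚ_[3]))‖ ≤ ‖X'‖⁻¹ ^ 2 :=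
    norm_heightFourOneCoord_sub_padicLog_num_add_kappaE_mul_le hW hq h' hx' hz9'
  -- THE datum: `⟨Q,Q⟩ = ĥ₃(Q)`, `⟨nQ,nQ⟩ = ĥ₃(nQ) = n²⟨Q,Q⟩`
  have hpair : Dh.pairing (.some x y h) (.some x y h) = heightFourOneCoord W 3 q x y := by
    rw [hDh _ hadm, heightFourOne_some]
  have hpair' : Dh.pairing (.some x' y' h') (.some x' y' h') = heightFourOneCoord W 3 q x' y' := by
    rw [hDh _ hadm', heightFourOne_some]
  have hsq : Dh.pairing (.some x' y' h') (.some x' y' h') =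
      (n : ℚ_[3]) ^ 2 * Dh.pairing (.some x y h) (.some x y h) := by
    rw [← hnQ, map_nsmul, map_nsmul, AddMonoidHom.nsmul_apply, smul_smul, nsmul_eq_mul]
    push_cast; ring
  -- `den/num = 1/x`, `‖1/x − ℓ²‖ ≤ 3‖z‖⁴` at both points
  have hnum : ((x.num : ℚ) : ℚ_[3]) = X * ((x.den : ℚ) : ℚ_[3]) := by
    rw [hXdef, ← Rat.cast_mul, Rat.mul_den_eq_num]
  have hnum' : ((x'.num : ℚ) : ℚ_[3]) = X' * ((x'.den : ℚ) : ℚ_[3]) := by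
    rw [hX'def, ← Rat.cast_mul, Rat.mul_den_eq_num]
  have hd0 : ((x.den : ℚ) : ℚ_[3]) ≠ 0 := by exact_mod_cast x.den_nz
  have hd0' : ((x'.den : ℚ) : ℚ_[3]) ≠ 0 := by exact_mod_cast x'.den_nz
  have hDa : ((x.den : ℚ) : ℚ_[3]) / ((x.num : ℚ) : ℚ_[3]) = X⁻¹ := by rw [hnum]; field_simp
  have hDa' : ((x'.den : ℚ) : ℚ_[3]) / ((x'.num : ℚ) : ℚ_[3]) = X'⁻¹ := by rw [hnum']; field_simp
  have heq : V.toAffine.Equation X (y : ℚ_[3]) := (nonsingular_ratCast (p := 3) h).left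
  have heq' : V.toAffine.Equation X' (y' : ℚ_[3]) := (nonsingular_ratCast (p := 3) h').left
  obtain ⟨hb2n, hb4n⟩ : ‖V.b₂‖ ≤ 1 ∧ ‖V.b₄‖ ≤ 1 := by
    have hI := V.eq_map_integralModel
    refine ⟨?_, ?_⟩
    · have e := congrArg WeierstrassCurve.b₂ hI
      rw [map_b₂] at e; rw [← e]; exact PadicInt.norm_le_one _
    · have e := congrArg WeierstrassCurve.b₄ hI
      rw [map_b₄] at e; rw [← e]; exact PadicInt.norm_le_one _
  have hXi2 : ‖X⁻¹‖ = ‖z‖ ^ 2 := by rw [norm_inv, hz2]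
  have hXi2' : ‖X'⁻¹‖ = ‖z'‖ ^ 2 := by rw [norm_inv, hz2']
  have hXℓ : ‖X * ℓ ^ 2 - 1 + V.b₂ / 12 * ℓ ^ 2 - (V.b₂ ^ 2 - 24 * V.b₄) / 240 * ℓ ^ 4‖ ≤ ‖z‖ ^ 4 := by
    have hh := norm_x_mul_formalLog_sq_sub_le V heq hx hz9X
    rw [← hz2] at hh
    exact hh.trans_eq (by ring)
  have hXℓ' : ‖X' * ℓ' ^ 2 - 1 + V.b₂ / 12 * ℓ' ^ 2 - (V.b₂ ^ 2 - 24 * V.b₄) / 240 * ℓ' ^ 4‖ ≤ ‖z'‖ ^ 4 := by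
    have hh := norm_x_mul_formalLog_sq_sub_le V heq' hx' hz9'
    rw [← hz2'] at hh
    exact hh.trans_eq (by ring)
  have hℓX : ‖ℓ ^ 2 - X⁻¹‖ ≤ 3 * ‖z‖ ^ 4 :=
    norm_formalLog_sq_sub_inv_le hX0' hXi2 hℓn hzz hz9X hb2n hb4n hXℓ
  have hℓX' : ‖ℓ' ^ 2 - X'⁻¹‖ ≤ 3 * ‖z'‖ ^ 4 :=
    norm_formalLog_sq_sub_inv_le hX'0' hXi2' hℓ'n hzz' hz9' hb2n hb4n hXℓ'
  have hκ : ‖κ‖ ≤ 1 := norm_kappaE_le_one hW hq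
  -- assemble
  have e : padicLog 3 ((x'.num : ℚ) : ℚ_[3]) - (n : ℚ_[3]) ^ 2 * padicLog 3 ((x.num : ℚ) : ℚ_[3]) =
      -(heightFourOneCoord W 3 q x' y' - padicLog 3 ((x'.num : ℚ) : ℚ_[3]) +
          κ * (((x'.den : ℚ) : ℚ_[3]) / ((x'.num : ℚ) : ℚ_[3]))) +
        (n : ℚ_[3]) ^ 2 * (heightFourOneCoord W 3 q x y - padicLog 3 ((x.num : ℚ) : ℚ_[3]) +
          κ * (((x.den : ℚ) : ℚ_[3]) / ((x.num : ℚ) : ℚ_[3]))) -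
        κ * ((ℓ' ^ 2 - X'⁻¹) - (n : ℚ_[3]) ^ 2 * (ℓ ^ 2 - X⁻¹)) := by
    rw [hDa, hDa', ← hpair, ← hpair', hsq, hℓmul]; ring
  rw [e]
  have hn4 : ‖(n : ℚ_[3])‖ ^ 4 ≤ ‖(n : ℚ_[3])‖ ^ 2 := by
    calc ‖(n : ℚ_[3])‖ ^ 4 = ‖(n : ℚ_[3])‖ ^ 2 * ‖(n : ℚ_[3])‖ ^ 2 := by ring
      _ ≤ ‖(n : ℚ_[3])‖ ^ 2 * 1 := by gcongr; exact pow_le_one₀ (norm_nonneg _) hnn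
      _ = ‖(n : ℚ_[3])‖ ^ 2 := mul_one _
  have hz4 : ‖z‖ ^ 4 = ‖X‖⁻¹ ^ 2 := by rw [← hz2]; ring
  have hz4' : ‖z'‖ ^ 4 = ‖(n : ℚ_[3])‖ ^ 4 * ‖X‖⁻¹ ^ 2 := by
    rw [show ‖z'‖ ^ 4 = (‖z'‖ ^ 2) ^ 2 by ring, hz2', hXrel]; ring
  refine (norm_sub_le_max₃ _ _).trans (max_le ((norm_add_le_max _ _).trans (max_le ?_ ?_)) ?_)
  · rw [norm_neg]
    refine hB.trans ?_
    rw [hXrel, mul_pow, ← pow_mul, show 2 * 2 = 4 by norm_num]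
    calc ‖(n : ℚ_[3])‖ ^ 4 * ‖X‖⁻¹ ^ 2 ≤ ‖(n : ℚ_[3])‖ ^ 2 * ‖X‖⁻¹ ^ 2 := by gcongr
      _ = 1 * ‖(n : ℚ_[3])‖ ^ 2 * ‖X‖⁻¹ ^ 2 := by ring
      _ ≤ 3 * ‖(n : ℚ_[3])‖ ^ 2 * ‖X‖⁻¹ ^ 2 := by gcongr; norm_num
  · rw [norm_mul, norm_pow]
    calc ‖(n : ℚ_[3])‖ ^ 2 * _ ≤ ‖(n : ℚ_[3])‖ ^ 2 * ‖X‖⁻¹ ^ 2 := by gcongr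
      _ = 1 * ‖(n : ℚ_[3])‖ ^ 2 * ‖X‖⁻¹ ^ 2 := by ring
      _ ≤ 3 * ‖(n : ℚ_[3])‖ ^ 2 * ‖X‖⁻¹ ^ 2 := by gcongr; norm_num
  · rw [norm_mul]
    have hin : ‖(ℓ' ^ 2 - X'⁻¹) - (n : ℚ_[3]) ^ 2 * (ℓ ^ 2 - X⁻¹)‖ ≤ 3 * ‖(n : ℚ_[3])‖ ^ 2 * ‖X‖⁻¹ ^ 2 := by
      refine (norm_sub_le_max₃ _ _).trans (max_le (hℓX'.trans ?_) ?_)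
      · rw [hz4']
        calc 3 * (‖(n : ℚ_[3])‖ ^ 4 * ‖X‖⁻¹ ^ 2) ≤ 3 * (‖(n : ℚ_[3])‖ ^ 2 * ‖X‖⁻¹ ^ 2) := by gcongr
          _ = 3 * ‖(n : ℚ_[3])‖ ^ 2 * ‖X‖⁻¹ ^ 2 := by ring
      · rw [norm_mul, norm_pow]
        calc ‖(n : ℚ_[3])‖ ^ 2 * ‖ℓ ^ 2 - X⁻¹‖ ≤ ‖(n : ℚ_[3])‖ ^ 2 * (3 * ‖z‖ ^ 4) := by gcongr
          _ = 3 * ‖(n : ℚ_[3])‖ ^ 2 * ‖X‖⁻¹ ^ 2 := by rw [hz4]; ring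
    calc ‖κ‖ * _ ≤ 1 * (3 * ‖(n : ℚ_[3])‖ ^ 2 * ‖X‖⁻¹ ^ 2) := by gcongr
      _ = 3 * ‖(n : ℚ_[3])‖ ^ 2 * ‖X‖⁻¹ ^ 2 := one_mul _

/-- **The tripling congruence** (`n = 3`): under the same hypotheses, with `3 • Q = (x', y')`:
`‖log₃ num x' − 9·log₃ num x‖₃ ≤ 3⁻¹·‖x‖₃⁻²`, i.e. **`log₃ num x(3Q) ≡ 9·log₃ num x(Q) (mod 3^{4k+1})`** for a
point of level `k ≥ 2` — observed with EQUALITY of valuations on 469 of lane A's 690 rows (all levels).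
[cite: SteinWuthrich2013, §4.1 eq. (4.1), §4.2] [cite: MazurSteinTate2006, §1] -/
theorem norm_padicLog_num_three_nsmul_sub_nine_mul_le [W.IsElliptic] [W.IsGloballyMinimal] (hW : Mult W 3)
    (hns : ¬ W.HasSplitMultiplicativeReductionAtPrime 3) {x y : ℚ} {h : W.toAffine.Nonsingular x y}
    (hadm : W.IsAdmissible 3 (.some x y h)) (hz9 : ‖-(x : ℚ_[3]) / y‖ ≤ 1 / 9)
    {x' y' : ℚ} {h' : W.toAffine.Nonsingular x' y'} (h3Q : 3 • (.some x y h : W.toAffine.Point) = .some x' y' h') :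
    ‖padicLog 3 ((x'.num : ℚ) : ℚ_[3]) - 9 * padicLog 3 ((x.num : ℚ) : ℚ_[3])‖ ≤ 3⁻¹ * ‖(x : ℚ_[3])‖⁻¹ ^ 2 := by
  have hh := norm_padicLog_num_nsmul_sub_sq_mul_le hW hns hadm hz9 (n := 3) (by norm_num) h3Q
  have h3n : ‖((3 : ℕ) : ℚ_[3])‖ = 1 / 3 := by rw [Padic.norm_p]; norm_num
  rw [h3n] at hh
  have e : ((3 : ℕ) : ℚ_[3]) ^ 2 = 9 := by norm_num
  rw [e] at hh
  refine hh.trans_eq ?_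
  norm_num

end Tower

end Summit.BirchSwinnertonDyer.Rank1Residual.X11b.RegMult.HeightLogNumerator

end
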